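import Literature.MathematicalPhysics.QuantumFieldTheory.Balaban1983to89.MassGapOpenBoundaryConversion
import Literature.MathematicalPhysics.QuantumFieldTheory.Balaban1983to89.MassGapLipschitzClass
import HarnessLib

/-!
# Typed sufficient conditions for the Jaffe–Witten lattice mass-gap clause, §23: open-boundary time clustering
# of the GAUGE-INVARIANT LIPSCHITZ / WILSON-LOOP-POLYNOMIAL classes ⇒ JW's transfer gap, same rate (kernel)

HONEST FRAMING (audit package `pub-balaban`, seat `b2b-balaban-ir-2`, generation 15, 2026-08-19).  This module is §23
of the lineage `Balaban1983to89/MassGapFunctionalInequalities.lean`; it closes the modelling seam (61) of census §II.24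
(successor task T1b): §22 (`MassGapOpenBoundaryConversion.lean`) converts open-boundary time clustering of ALL BOUNDED
MEASURABLE slice functions into §12's `GroundStateClustering`; the functional-inequality literature, however, controls
GAUGE-INVARIANT LIPSCHITZ cylinder functions (the class of §18, `IsTimeZeroLipschitz`, after Shen–Zhu–Zhu's `C^∞_cyl`),
and the textbook observables are the gauge-invariant POLYNOMIALS in the link entries (Wilson loops; §18f–g,
`IsLinkPolynomial`).  Both smaller classes are TOTAL FOR `𝕋` by §18 (`MassGapLipschitzClass.lean`:
`wilsonTorusTransferMatrix_eq_zero_of_forall_inner_lipschitzInvariant`, `…_polynomialInvariant`: a vector orthogonal to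
every `F·Ω` lies in `ker 𝕋`, which is all §12 asks).  Hence, in the kernel, for every compact second-countable `G`,
continuous unitary FAITHFUL `ρ`, every real `β` (and `β ≥ 0` for the operator gap):

* §23a `exists_vacuum_clustering_of_openBoundaryTimeClustering` — §22's argument packaged per observable: the
  Perron–Frobenius–Jentzsch vacuum `Ω` of Lüscher's transfer matrix and, for every bounded measurable `f ∈ 𝒞`, the §12 bound
  for `v = f·Ω` with the hypothesis' constant at the hypothesis' rate; §23a′: `ρ`-Lipschitz functions and link polynomials
  are bounded measurable slice functions (`measurable_of_isTimeZeroLipschitz`, `exists_bound_of_isTimeZeroLipschitz`,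
  `measurable_of_isLinkPolynomial`, `exists_bound_of_isLinkPolynomial`), and an `L²` vector a.e. equal to `F·Ω` is `M_F Ω`
  (`eq_mulL_of_ae_eq`).
* §23b `lipschitzGaugeInvariantClustering_of_openBoundaryTimeClustering` (`𝒞 ⊇` gauge-invariant `ρ`-Lipschitz),
  `polynomialGaugeInvariantClustering_of_openBoundaryTimeClustering` (`𝒞 ⊇` gauge-invariant link polynomials) — any real `β`,
  no faithfulness needed; then, with §18's totality (faithful `ρ`), `groundStateClustering_of_openBoundaryLipschitzClustering`,
  `transferOperatorGap_of_openBoundaryLipschitzClustering`, and the polynomial twins.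
* §23c the two named observable classes `lipschitzInvariantClass ρ L`, `polynomialInvariantClass ρ L` and the headline
  corollaries `transferOperatorGap_of_openBoundaryTimeClustering_lipschitzClass` /
  `transferOperatorGap_of_openBoundaryTimeClustering_polynomialClass`:
  uniform-in-`(s, T)` exponential clustering at lattice rate `m` of the open-temporal-boundary expectations of
  gauge-invariant Wilson-loop polynomials of ONE time slice ⇒ `‖𝕋 w‖ ≤ e^{−m} ‖𝕋‖ ‖w‖` on `Ω^⊥`.

WHAT THIS IS NOT.  No functional inequality, clustering bound or gap for any Wilson measure is asserted; every theorem is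
[folklore] and takes the clustering as a HYPOTHESIS (`OpenBoundaryTimeClustering`, §21).  Whether it holds for `SU(N)`,
`d = 4`, at weak coupling uniformly in the spatial size `S` is the open problem, re-typed.  EXPLICITLY A LOTTERY, not a
path to the Clay problem; value = typed kernel dictionary.  No published theorem is used as a hypothesis; the sources
below are orientation for the observable classes only.

References (orientation): H. Shen, R. Zhu, X. Zhu, *A stochastic analysis approach to lattice Yang–Mills at strong
coupling*, Comm. Math. Phys. 400 (2023), arXiv:2204.12737, §1 and Cor. 1.6 (the cylinder-function class); I. Montvay,
G. Münster, *Quantum Fields on a Lattice* (1994), §3.2.4 (3.111)–(3.112) (Wilson loops as the observables), §3.2.6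
(3.144)–(3.152); M. Lüscher, S. Schaefer, JHEP 07 (2011) 036, arXiv:1105.4749, §2.4 (the open temporal boundary).
-/

noncomputable section

open MeasureTheory Filter Function Topology
open scoped BigOperators RealInnerProductSpace ENNReal NNReal
open Literature.Analysis.OperatorTheory Literature.MathematicalPhysics.QuantumFieldTheory

namespace Literature.MathematicalPhysics.QuantumFieldTheory.Balaban1983to89.Sufficient.OpenBoundary

/-! #### §23a The vacuum and the per-observable bound (§22 packaged) -/

section Vacuum

variable {G : Type} [Group G] [TopologicalSpace G] [IsTopologicalGroup G] [CompactSpace G]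
  [MeasurableSpace G] [BorelSpace G] [SecondCountableTopology G] {N : ℕ} {ρ : G →* Matrix (Fin N) (Fin N) ℂ}
  (β : ℝ)

omit [SecondCountableTopology G] in
/-- The hypothesis schema is antitone in the observable class (§21's `OpenBoundaryTimeClustering.anti` is antitonicity in
the rate). [folklore] -/
theorem OpenBoundaryTimeClustering.of_subset {L : ℕ} [NeZero L] {𝒞 𝒞' : Set (GaugeConfig 3 L G → ℝ)} {m : ℝ}
    (h𝒞 : 𝒞 ⊆ 𝒞') (h : OpenBoundaryTimeClustering ρ β L 𝒞' m) : OpenBoundaryTimeClustering ρ β L 𝒞 m :=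
  fun f hf => h f (h𝒞 hf)

/-- **THE VACUUM AND THE PER-OBSERVABLE BOUND (kernel; every real `β`; continuous unitary `ρ`).**  Under
`OpenBoundaryTimeClustering ρ β (2S+1) 𝒞 m`: Lüscher's transfer matrix `𝕋` of the spatial torus `(ℤ/(2S+1))³` has a unit
top eigenvector `Ω`, strictly positive a.e. (Perron–Frobenius–Jentzsch, tree `IsPositivityImproving.exists_norm_pow_sub_le`),
such that for every bounded measurable `f ∈ 𝒞` the vector `v = M_f Ω = f·Ω` satisfies §12's clustering bound
`⟪v, 𝕋^t v⟫ − ‖𝕋‖^t ⟪Ω, v⟫² ≤ K_f (e^{−m} ‖𝕋‖)^t` for all `t ≥ 1`, with the hypothesis' constant `K_f` (§22's core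
`inner_pow_mulL_sub_le`, uniform-in-`s` three-ratio clustering and power iteration `λ₀^{-s} 𝕋^s 𝟙 → ⟪Ω, 𝟙⟫ Ω`).
[folklore] -/
theorem exists_vacuum_clustering_of_openBoundaryTimeClustering (hρ : Continuous ρ)
    (hρu : ∀ g, ρ g ∈ Matrix.unitaryGroup (Fin N) ℂ) (S : ℕ) {𝒞 : Set (GaugeConfig 3 (2 * S + 1) G → ℝ)} {m : ℝ}
    (h : OpenBoundaryTimeClustering ρ β (2 * S + 1) 𝒞 m) :
    ∃ φ : Lp ℝ 2 (Measure.pi fun _ : Edge 3 (2 * S + 1) => haarProbability G), ‖φ‖ = 1 ∧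
      wilsonTorusTransferMatrix ρ β (2 * S + 1) φ = ‖wilsonTorusTransferMatrix ρ β (2 * S + 1)‖ • φ ∧
      IsStrictlyPositiveFun φ ∧
      ∀ (f : GaugeConfig 3 (2 * S + 1) G → ℝ) (hf : Measurable f) (B : ℝ) (hfb : ∀ U, ‖f U‖ ≤ B), f ∈ 𝒞 →
        ∃ K : ℝ, ∀ t : ℕ, 1 ≤ t →
          ⟪mulL hf hfb φ, (wilsonTorusTransferMatrix ρ β (2 * S + 1) ^ t) (mulL hf hfb φ)⟫ -
              ‖wilsonTorusTransferMatrix ρ β (2 * S + 1)‖ ^ t * ⟪φ, mulL hf hfb φ⟫ ^ 2 ≤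
            K * (Real.exp (-m) * ‖wilsonTorusTransferMatrix ρ β (2 * S + 1)‖) ^ t := by
  obtain ⟨C, hC⟩ := exists_norm_wilsonSliceKernel_le (L := 2 * S + 1) ρ hρ β
  have hK := stronglyMeasurable_uncurry_wilsonSliceKernel (L := 2 * S + 1) ρ hρ β
  have hA := wilsonTorusTransferMatrix_ae_eq β (2 * S + 1) hρ
  have hsa := isSelfAdjoint_wilsonTorusTransferMatrix (2 * S + 1) hρ hρu β
  obtain ⟨φ, hφ1, hφpos, hAφ, θ, hθ0, hθ, hpow⟩ :=
    (isPositivityImproving_wilsonTorusTransferMatrix β (2 * S + 1) hρ).exists_norm_pow_sub_le hsa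
      (isCompactOperator_wilsonTorusTransferMatrix β (2 * S + 1) hρ)
      (wilsonTorusTransferMatrix_ne_zero β (2 * S + 1) hρ)
  refine ⟨φ, hφ1, hAφ, hφpos, fun f hf B hfb hf𝒞 => ?_⟩
  obtain ⟨Kc, hKc⟩ := h f hf𝒞
  have hB : 0 ≤ B := (norm_nonneg _).trans (hfb 1)
  refine ⟨Kc, fun t ht => ?_⟩
  exact inner_pow_mulL_sub_le hK hC hA hsa hφ1 hφpos hAφ hθ0 hθ hpow hf hfb hB ht fun s => by
    have h1 := hKc (s + t + s) s t ht (by omega)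
    simpa only [openExpectation_sliceObs β (2 * S + 1) hρ hf hfb] using h1

omit [SecondCountableTopology G] in
/-- An `L²` vector a.e. equal to `f·φ` IS `M_f φ`. [folklore] -/
theorem eq_mulL_of_ae_eq {L : ℕ} [NeZero L] {f : GaugeConfig 3 L G → ℝ} (hf : Measurable f) {B : ℝ} (hfb : ∀ U, ‖f U‖ ≤ B)
    (φ v : Lp ℝ 2 (Measure.pi fun _ : Edge 3 L => haarProbability G))
    (hv : (v : GaugeConfig 3 L G → ℝ) =ᵐ[Measure.pi fun _ : Edge 3 L => haarProbability G] fun U => f U * φ U) :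
    v = mulL hf hfb φ :=
  Lp.ext (hv.trans (mulL_coeFn hf hfb φ).symm)

end Vacuum

/-! #### §23a′ Lipschitz functions and link polynomials are bounded measurable slice functions -/

section Measurability

variable {G : Type} [Group G] [TopologicalSpace G] [MeasurableSpace G] [BorelSpace G] [SecondCountableTopology G]
  {N : ℕ} {ρ : G →* Matrix (Fin N) (Fin N) ℂ} {L : ℕ} [NeZero L]

/-- A `ρ`-Lipschitz time-zero function is measurable (continuous `ρ`; Borel structure of the second-countable
configuration space `G^{E₃}`). [folklore] -/
theorem measurable_of_isTimeZeroLipschitz (hρ : Continuous ρ) {F : GaugeConfig 3 L G → ℝ} {K : ℝ≥0}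
    (hK : IsTimeZeroLipschitz ρ F K) : Measurable F :=
  (hK.continuous hρ).measurable

/-- A link polynomial is measurable (continuous `ρ`). [folklore] -/
theorem measurable_of_isLinkPolynomial (hρ : Continuous ρ) {F : GaugeConfig 3 L G → ℝ} (hF : IsLinkPolynomial ρ F) :
    Measurable F :=
  (hF.continuous hρ).measurable

end Measurability

section Boundedness

variable {G : Type} [Group G] [TopologicalSpace G] [CompactSpace G] {N : ℕ} {ρ : G →* Matrix (Fin N) (Fin N) ℂ}
  {L : ℕ}

/-- A `ρ`-Lipschitz time-zero function is bounded (compact configuration space). [folklore] -/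
theorem exists_bound_of_isTimeZeroLipschitz [NeZero L] (hρ : Continuous ρ) {F : GaugeConfig 3 L G → ℝ} {K : ℝ≥0}
    (hK : IsTimeZeroLipschitz ρ F K) : ∃ B : ℝ, ∀ U, ‖F U‖ ≤ B :=
  ⟨‖BoundedContinuousFunction.mkOfCompact ⟨F, hK.continuous hρ⟩‖, fun U =>
    (BoundedContinuousFunction.mkOfCompact ⟨F, hK.continuous hρ⟩).norm_coe_le_norm U⟩

/-- A link polynomial is bounded (compact configuration space). [folklore] -/
theorem exists_bound_of_isLinkPolynomial (hρ : Continuous ρ) {F : GaugeConfig 3 L G → ℝ} (hF : IsLinkPolynomial ρ F) :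
    ∃ B : ℝ, ∀ U, ‖F U‖ ≤ B :=
  ⟨‖BoundedContinuousFunction.mkOfCompact ⟨F, hF.continuous hρ⟩‖, fun U =>
    (BoundedContinuousFunction.mkOfCompact ⟨F, hF.continuous hρ⟩).norm_coe_le_norm U⟩

end Boundedness


/-! #### §23b The Lipschitz and polynomial instantiations -/

section Classes

variable {G : Type} [Group G] [TopologicalSpace G] [IsTopologicalGroup G] [CompactSpace G]
  [MeasurableSpace G] [BorelSpace G] [SecondCountableTopology G] {N : ℕ} {ρ : G →* Matrix (Fin N) (Fin N) ℂ}
  (β : ℝ)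

/-- **OPEN-BOUNDARY TIME CLUSTERING OF THE GAUGE-INVARIANT LIPSCHITZ CLASS ⇒ §18e's `LipschitzGaugeInvariantClustering`
(kernel; every real `β`; continuous unitary `ρ`; no faithfulness needed here).**  For `F` gauge invariant and
`ρ`-Lipschitz, `F` is bounded measurable, every `v` a.e. equal to `F·Ω` is `M_F Ω`, and §23a gives the bound with the
hypothesis' constant. [folklore] -/
theorem lipschitzGaugeInvariantClustering_of_openBoundaryTimeClustering (hρ : Continuous ρ)
    (hρu : ∀ g, ρ g ∈ Matrix.unitaryGroup (Fin N) ℂ) (S : ℕ) {𝒞 : Set (GaugeConfig 3 (2 * S + 1) G → ℝ)} {m : ℝ}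
    (h𝒞 : ∀ (F : GaugeConfig 3 (2 * S + 1) G → ℝ) (K : ℝ≥0), IsGaugeInvariant F → IsTimeZeroLipschitz ρ F K → F ∈ 𝒞)
    (h : OpenBoundaryTimeClustering ρ β (2 * S + 1) 𝒞 m) : LipschitzGaugeInvariantClustering ρ β S m := by
  obtain ⟨φ, hφ1, hAφ, -, hcl⟩ := exists_vacuum_clustering_of_openBoundaryTimeClustering β hρ hρu S h
  refine ⟨φ, hφ1, hAφ, fun F K hF hK v hv => ?_⟩
  obtain ⟨B, hFb⟩ := exists_bound_of_isTimeZeroLipschitz hρ hK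
  have hFm : Measurable F := measurable_of_isTimeZeroLipschitz hρ hK
  obtain ⟨K', hK'⟩ := hcl F hFm B hFb (h𝒞 F K hF hK)
  rw [eq_mulL_of_ae_eq hFm hFb φ v hv]
  exact ⟨K', eventually_atTop.2 ⟨1, hK'⟩⟩

/-- **OPEN-BOUNDARY TIME CLUSTERING OF THE GAUGE-INVARIANT LINK POLYNOMIALS (Wilson-loop polynomials for unitary `ρ`)
⇒ §18g's `PolynomialGaugeInvariantClustering` (kernel; every real `β`; continuous unitary `ρ`).** [folklore] -/
theorem polynomialGaugeInvariantClustering_of_openBoundaryTimeClustering (hρ : Continuous ρ)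
    (hρu : ∀ g, ρ g ∈ Matrix.unitaryGroup (Fin N) ℂ) (S : ℕ) {𝒞 : Set (GaugeConfig 3 (2 * S + 1) G → ℝ)} {m : ℝ}
    (h𝒞 : ∀ F : GaugeConfig 3 (2 * S + 1) G → ℝ, IsGaugeInvariant F → IsLinkPolynomial ρ F → F ∈ 𝒞)
    (h : OpenBoundaryTimeClustering ρ β (2 * S + 1) 𝒞 m) : PolynomialGaugeInvariantClustering ρ β S m := by
  obtain ⟨φ, hφ1, hAφ, -, hcl⟩ := exists_vacuum_clustering_of_openBoundaryTimeClustering β hρ hρu S h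
  refine ⟨φ, hφ1, hAφ, fun F hF hP v hv => ?_⟩
  obtain ⟨B, hFb⟩ := exists_bound_of_isLinkPolynomial hρ hP
  have hFm : Measurable F := measurable_of_isLinkPolynomial hρ hP
  obtain ⟨K', hK'⟩ := hcl F hFm B hFb (h𝒞 F hF hP)
  rw [eq_mulL_of_ae_eq hFm hFb φ v hv]
  exact ⟨K', eventually_atTop.2 ⟨1, hK'⟩⟩

/-- **Lipschitz-class open-boundary clustering ⇒ §12's ground-state clustering (kernel; every real `β`; continuous unitary
FAITHFUL `ρ` — faithfulness feeds §18's totality `wilsonTorusTransferMatrix_eq_zero_of_forall_inner_lipschitzInvariant`).**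
[folklore] -/
theorem groundStateClustering_of_openBoundaryLipschitzClustering (hρ : Continuous ρ)
    (hρu : ∀ g, ρ g ∈ Matrix.unitaryGroup (Fin N) ℂ) (hρi : Function.Injective ρ) (S : ℕ)
    {𝒞 : Set (GaugeConfig 3 (2 * S + 1) G → ℝ)} {m : ℝ}
    (h𝒞 : ∀ (F : GaugeConfig 3 (2 * S + 1) G → ℝ) (K : ℝ≥0), IsGaugeInvariant F → IsTimeZeroLipschitz ρ F K → F ∈ 𝒞)
    (h : OpenBoundaryTimeClustering ρ β (2 * S + 1) 𝒞 m) : GroundStateClustering ρ β S m :=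
  groundStateClustering_of_lipschitzGaugeInvariantClustering hρ hρu hρi β S
    (lipschitzGaugeInvariantClustering_of_openBoundaryTimeClustering β hρ hρu S h𝒞 h)

/-- **Lipschitz-class open-boundary clustering ⇒ JW's transfer gap, SAME rate (kernel; `β ≥ 0`; continuous unitary
faithful `ρ`).**  This is the form in which a Poincaré / log-Sobolev inequality for the Langevin dynamics of the
OPEN-temporal-boundary Wilson measure — which controls gauge-invariant Lipschitz cylinder functions — would enter the
Jaffe–Witten clause: it would have to give the hypothesis with `m` bounded below uniformly in `S`. [folklore] -/
theorem transferOperatorGap_of_openBoundaryLipschitzClustering (hρ : Continuous ρ)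
    (hρu : ∀ g, ρ g ∈ Matrix.unitaryGroup (Fin N) ℂ) (hρi : Function.Injective ρ) {β : ℝ} (hβ : 0 ≤ β) (S : ℕ)
    {𝒞 : Set (GaugeConfig 3 (2 * S + 1) G → ℝ)} {m : ℝ}
    (h𝒞 : ∀ (F : GaugeConfig 3 (2 * S + 1) G → ℝ) (K : ℝ≥0), IsGaugeInvariant F → IsTimeZeroLipschitz ρ F K → F ∈ 𝒞)
    (h : OpenBoundaryTimeClustering ρ β (2 * S + 1) 𝒞 m) : TransferOperatorGap ρ β S m :=
  transferOperatorGap_of_lipschitzGaugeInvariantClustering hρ hρu hρi hβ S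
    (lipschitzGaugeInvariantClustering_of_openBoundaryTimeClustering β hρ hρu S h𝒞 h)

/-- **Polynomial-class open-boundary clustering ⇒ §12's ground-state clustering (kernel; every real `β`; continuous
unitary faithful `ρ`).** [folklore] -/
theorem groundStateClustering_of_openBoundaryPolynomialClustering (hρ : Continuous ρ)
    (hρu : ∀ g, ρ g ∈ Matrix.unitaryGroup (Fin N) ℂ) (hρi : Function.Injective ρ) (S : ℕ)
    {𝒞 : Set (GaugeConfig 3 (2 * S + 1) G → ℝ)} {m : ℝ}
    (h𝒞 : ∀ F : GaugeConfig 3 (2 * S + 1) G → ℝ, IsGaugeInvariant F → IsLinkPolynomial ρ F → F ∈ 𝒞)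
    (h : OpenBoundaryTimeClustering ρ β (2 * S + 1) 𝒞 m) : GroundStateClustering ρ β S m :=
  groundStateClustering_of_polynomialGaugeInvariantClustering hρ hρu hρi β S
    (polynomialGaugeInvariantClustering_of_openBoundaryTimeClustering β hρ hρu S h𝒞 h)

/-- **Polynomial-class open-boundary clustering ⇒ JW's transfer gap, SAME rate (kernel; `β ≥ 0`; continuous unitary
faithful `ρ`).** [folklore] -/
theorem transferOperatorGap_of_openBoundaryPolynomialClustering (hρ : Continuous ρ)
    (hρu : ∀ g, ρ g ∈ Matrix.unitaryGroup (Fin N) ℂ) (hρi : Function.Injective ρ) {β : ℝ} (hβ : 0 ≤ β) (S : ℕ)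
    {𝒞 : Set (GaugeConfig 3 (2 * S + 1) G → ℝ)} {m : ℝ}
    (h𝒞 : ∀ F : GaugeConfig 3 (2 * S + 1) G → ℝ, IsGaugeInvariant F → IsLinkPolynomial ρ F → F ∈ 𝒞)
    (h : OpenBoundaryTimeClustering ρ β (2 * S + 1) 𝒞 m) : TransferOperatorGap ρ β S m :=
  transferOperatorGap_of_polynomialGaugeInvariantClustering hρ hρu hρi hβ S
    (polynomialGaugeInvariantClustering_of_openBoundaryTimeClustering β hρ hρu S h𝒞 h)

end Classes

/-! #### §23c The two named observable classes and the headline corollaries -/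

section Named

variable {G : Type} [Group G] {N : ℕ}

/-- The gauge-invariant `ρ`-Lipschitz slice observables (the functional-inequality class of §18, after Shen–Zhu–Zhu's
cylinder functions). Hypothesis-side notion; no claim. [folklore] [cite: arXiv220412737, Section 1 and Corollary 1.6] -/
def lipschitzInvariantClass (ρ : G →* Matrix (Fin N) (Fin N) ℂ) (L : ℕ) [NeZero L] : Set (GaugeConfig 3 L G → ℝ) :=
  {F | IsGaugeInvariant F ∧ ∃ K : ℝ≥0, IsTimeZeroLipschitz ρ F K}

/-- The gauge-invariant real polynomials in the link entries `ρ(U_e)_{ij}` of one time slice (for unitary `ρ`: the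
polynomials in Wilson loops — the textbook observables, [MM94] §3.2.4 (3.111)–(3.112)). Hypothesis-side notion; no claim.
[folklore] [cite: MontvayMunster1994, §3.2.4 (3.111)-(3.112)] -/
def polynomialInvariantClass (ρ : G →* Matrix (Fin N) (Fin N) ℂ) (L : ℕ) : Set (GaugeConfig 3 L G → ℝ) :=
  {F | IsGaugeInvariant F ∧ IsLinkPolynomial ρ F}

/-- Membership in the Lipschitz class, unfolded. [folklore] -/
theorem mem_lipschitzInvariantClass {ρ : G →* Matrix (Fin N) (Fin N) ℂ} {L : ℕ} [NeZero L]
    {F : GaugeConfig 3 L G → ℝ} :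
    F ∈ lipschitzInvariantClass ρ L ↔ IsGaugeInvariant F ∧ ∃ K : ℝ≥0, IsTimeZeroLipschitz ρ F K :=
  Iff.rfl

/-- Membership in the polynomial class, unfolded. [folklore] -/
theorem mem_polynomialInvariantClass {ρ : G →* Matrix (Fin N) (Fin N) ℂ} {L : ℕ} {F : GaugeConfig 3 L G → ℝ} :
    F ∈ polynomialInvariantClass ρ L ↔ IsGaugeInvariant F ∧ IsLinkPolynomial ρ F :=
  Iff.rfl

variable [TopologicalSpace G] [CompactSpace G] {ρ : G →* Matrix (Fin N) (Fin N) ℂ}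

/-- For continuous faithful `ρ` the polynomial class is contained in the Lipschitz class (§18f). [folklore] -/
theorem polynomialInvariantClass_subset_lipschitzInvariantClass {L : ℕ} [NeZero L] (hρ : Continuous ρ)
    (hρi : Function.Injective ρ) : polynomialInvariantClass ρ L ⊆ lipschitzInvariantClass ρ L :=
  fun _ hF => ⟨hF.1, hF.2.exists_isTimeZeroLipschitz hρ hρi⟩

variable [IsTopologicalGroup G] [MeasurableSpace G] [BorelSpace G] [SecondCountableTopology G]

/-- **HEADLINE (Lipschitz class; kernel; `β ≥ 0`; continuous unitary faithful `ρ`):** uniform-in-`(s, T)` exponential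
clustering at lattice rate `m` of the open-temporal-boundary expectations of the gauge-invariant `ρ`-Lipschitz observables of
one time slice ⇒ JW's transfer gap `e^{−m}` on the spatial torus `(ℤ/(2S+1))³`. [folklore] -/
theorem transferOperatorGap_of_openBoundaryTimeClustering_lipschitzClass (hρ : Continuous ρ)
    (hρu : ∀ g, ρ g ∈ Matrix.unitaryGroup (Fin N) ℂ) (hρi : Function.Injective ρ) {β : ℝ} (hβ : 0 ≤ β) (S : ℕ)
    {m : ℝ} (h : OpenBoundaryTimeClustering ρ β (2 * S + 1) (lipschitzInvariantClass ρ (2 * S + 1)) m) :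
    TransferOperatorGap ρ β S m :=
  transferOperatorGap_of_openBoundaryLipschitzClustering hρ hρu hρi hβ S
    (𝒞 := lipschitzInvariantClass ρ (2 * S + 1)) (fun _ K hF hK => ⟨hF, K, hK⟩) h

/-- **HEADLINE (Wilson-loop polynomials; kernel; `β ≥ 0`; continuous unitary faithful `ρ`):** the same with the
hypothesis asked only of the gauge-invariant polynomials in the link entries. [folklore] -/
theorem transferOperatorGap_of_openBoundaryTimeClustering_polynomialClass (hρ : Continuous ρ)
    (hρu : ∀ g, ρ g ∈ Matrix.unitaryGroup (Fin N) ℂ) (hρi : Function.Injective ρ) {β : ℝ} (hβ : 0 ≤ β) (S : ℕ)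
    {m : ℝ} (h : OpenBoundaryTimeClustering ρ β (2 * S + 1) (polynomialInvariantClass ρ (2 * S + 1)) m) :
    TransferOperatorGap ρ β S m :=
  transferOperatorGap_of_openBoundaryPolynomialClustering hρ hρu hρi hβ S
    (𝒞 := polynomialInvariantClass ρ (2 * S + 1)) (fun _ hF hP => ⟨hF, hP⟩) h

/-- Ground-state clustering from the polynomial class, ANY real `β` (continuous unitary faithful `ρ`). [folklore] -/
theorem groundStateClustering_of_openBoundaryTimeClustering_polynomialClass (hρ : Continuous ρ)
    (hρu : ∀ g, ρ g ∈ Matrix.unitaryGroup (Fin N) ℂ) (hρi : Function.Injective ρ) (β : ℝ) (S : ℕ) {m : ℝ}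
    (h : OpenBoundaryTimeClustering ρ β (2 * S + 1) (polynomialInvariantClass ρ (2 * S + 1)) m) :
    GroundStateClustering ρ β S m :=
  groundStateClustering_of_openBoundaryPolynomialClustering β hρ hρu hρi S
    (𝒞 := polynomialInvariantClass ρ (2 * S + 1)) (fun _ hF hP => ⟨hF, hP⟩) h

omit [SecondCountableTopology G] in
/-- The Lipschitz-class hypothesis implies the polynomial-class hypothesis (continuous faithful `ρ`): the weakest typed
form of the open-boundary input is the polynomial one. [folklore] -/
theorem openBoundaryTimeClustering_polynomialClass_of_lipschitzClass {L : ℕ} [NeZero L] (hρ : Continuous ρ)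
    (hρi : Function.Injective ρ) (β : ℝ) {m : ℝ}
    (h : OpenBoundaryTimeClustering ρ β L (lipschitzInvariantClass ρ L) m) :
    OpenBoundaryTimeClustering ρ β L (polynomialInvariantClass ρ L) m :=
  OpenBoundaryTimeClustering.of_subset β (polynomialInvariantClass_subset_lipschitzInvariantClass (L := L) hρ hρi) h

end Named

end Literature.MathematicalPhysics.QuantumFieldTheory.Balaban1983to89.Sufficient.OpenBoundary

end
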